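import Summits.QuantumFields.YangMills.Theorems.VirialFluxGapRingTreeGaugeTransfer
import Summits.QuantumFields.YangMills.Theorems.VirialFluxGapSharpTwistedLaplaceSeparation
import HarnessLib

/-!
# The off-tube floor ON THE TREE-GAUGED SPACE: input `hfloor` of ✓`sharpTwistedLaplace_of_fixTubes`, modulo «tubes contain metric neighbourhoods»
# (layer (A)→(D) junction of the DIRECT Laplace road to ⟨stmt-QuantumFields-24204⟩ `VirialFluxGap.SharpTwistedLaplace`)

Helper module (free-hands work of width seat ym-line-sfw-p2-w2 g49, cell ym-idea-1).  With `ι(w, (f, g)) = (glue w ∷ f, g)` the embedding of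
`X_fix(L) = SU2^{off} × (GaugeConfig 3 L SU2)^{2L−1} × SU2^{sites}` into ring histories, `F_fix = F_z ∘ ι`, and the squared chordal distance `D` of ✓⟨24320⟩:
* `glue_tree_apply`, `image_ringDistSq_combGauged_subset` — a comb-gauged ring history is in the image of `ι`, so the `D(ι x, ·)`-values on comb-gauged zeros are
  `D(ι x, ι ·)`-values on zeros of `F_fix`;
* ★ `ringDeficit_fix_floor` — there are `K > 0`, `q ≥ 0`, `L₀` with: for `L ≥ L₀`, `z ≠ 0`, `ρ > 0` and every `x ∈ X_fix` whose squared chordal distance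
  `D(ι x, ι x')` to every zero `x'` of `F_fix` is at least `ρ`, `min((KL^q)⁻¹, ρ/(1010L⁶·KL^q)) ≤ F_fix(x)`
  (✓`ringDeficit_floor_off_tube` + ✓`sInf_ringDistSq_combGauged_zero_le`).
So the worker's `hfloor` reduces to: the chart tubes `T_s` cover `{x | inf_{x' ∈ Z_fix} D(ι x, ι x') < ρ}` for some `ρ ≥ 1/poly(L)` (tubular-neighbourhood
surjectivity, part of B2).  Everything is PROVED; no definitions, no named facts.  HONEST FRAMING: bookkeeping; ⟨24204⟩, ⟨24319⟩ and every rung stay OPEN;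
the Yang–Mills mass gap (Clay) is NOT touched; no summit is proved by a line.
-/

noncomputable section

open Set
open scoped BigOperators
open Literature.MathematicalPhysics.QuantumFieldTheory hiding SU2
open Literature.MathematicalPhysics.QuantumLattice
open Summit.QuantumFields.YangMills.Theorems.FemtoTransferGap
open Summit.QuantumFields.YangMills.Theorems.FemtoTransferGap.TT
open Summit.QuantumFields.YangMills.Theorems.VirialFluxGap.RingDeficit

namespace Summit.QuantumFields.YangMills.Theorems.QuantitativeLaplace

variable {L : ℕ} [NeZero L]

/-! ## §1 Comb-gauged ring histories are in the image of `ι` -/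

omit [NeZero L] in
/-- A configuration with trivial tree links is glued from its off-tree links. [folklore] -/
theorem glue_tree_apply {U : GaugeConfig 3 L SU2} (hU : ∀ e : Edge 3 L, treeEdge e = true → U e = 1) :
    glue (fun i : OffIdx L => U i.1) = U := by
  funext e
  by_cases he : treeEdge e = true
  · rw [glue_apply_of_tree _ he, hU e he]
  · rw [glue_apply_of_not_tree _ he]

/-- The `D(P, ·)`-values on comb-gauged zeros of `F_z` are `D(P, ι ·)`-values on zeros of `F_fix`. [folklore] -/
theorem image_ringDistSq_combGauged_subset (z : Fin 3 → Bool) (P : (Fin (2 * L - 1 + 1) → GaugeConfig 3 L SU2) × (Site 3 L → SU2)) :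
    ((fun Q : (Fin (2 * L - 1 + 1) → GaugeConfig 3 L SU2) × (Site 3 L → SU2) =>
        (∑ i : Fin (2 * L - 1 + 1), (6 * (L : ℝ) ^ 3 - timeCoupling su2Rep (P.1 i) (Q.1 i))) +
          ∑ x : Site 3 L, (2 - ((su2Rep (P.2 x * (Q.2 x)⁻¹)).trace).re)) ''
        {Q | ringDeficit L z Q = 0 ∧ ∀ e : Edge 3 L, treeEdge e = true → Q.1 0 e = 1}) ⊆
      (fun x' : (OffIdx L → SU2) × ((Fin (2 * L - 1) → GaugeConfig 3 L SU2) × (Site 3 L → SU2)) =>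
        (∑ i : Fin (2 * L - 1 + 1), (6 * (L : ℝ) ^ 3 - timeCoupling su2Rep (P.1 i)
          ((Fin.cons (glue x'.1) x'.2.1 : Fin (2 * L - 1 + 1) → GaugeConfig 3 L SU2) i))) +
          ∑ x : Site 3 L, (2 - ((su2Rep (P.2 x * (x'.2.2 x)⁻¹)).trace).re)) ''
        {x' | ringDeficit L z ((Fin.cons (glue x'.1) x'.2.1 : Fin (2 * L - 1 + 1) → GaugeConfig 3 L SU2), x'.2.2) = 0} := by
  rintro _ ⟨Q, ⟨hQ, hT⟩, rfl⟩
  refine ⟨((fun i : OffIdx L => Q.1 0 i.1), ((fun j : Fin (2 * L - 1) => Q.1 j.succ), Q.2)), ?_, ?_⟩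
  · have e : ((Fin.cons (glue fun i : OffIdx L => Q.1 0 i.1) (fun j : Fin (2 * L - 1) => Q.1 j.succ) :
        Fin (2 * L - 1 + 1) → GaugeConfig 3 L SU2), Q.2) = Q := by
      refine Prod.ext ?_ rfl
      show Fin.cons (glue fun i : OffIdx L => Q.1 0 i.1) (Fin.tail Q.1) = Q.1
      rw [glue_tree_apply hT, Fin.cons_self_tail]
    show ringDeficit L z _ = 0
    rw [e]; exact hQ
  · show (∑ i : Fin (2 * L - 1 + 1), (6 * (L : ℝ) ^ 3 - timeCoupling su2Rep (P.1 i)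
          ((Fin.cons (glue fun i : OffIdx L => Q.1 0 i.1) (Fin.tail Q.1) : Fin (2 * L - 1 + 1) → GaugeConfig 3 L SU2) i))) +
        ∑ x : Site 3 L, (2 - ((su2Rep (P.2 x * (Q.2 x)⁻¹)).trace).re) = _
    rw [glue_tree_apply hT, Fin.cons_self_tail]

/-! ## §2 The floor on the tree-gauged space -/

/-- ★ **The off-tube floor on `X_fix`**: `K > 0`, `q ≥ 0`, `L₀` such that for `L ≥ L₀`, `z ≠ 0`, `ρ > 0` and every `x ∈ X_fix` at squared chordal
distance `≥ ρ` (through `ι`) from every zero of `F_fix`, `min((KL^q)⁻¹, ρ/(1010L⁶·(KL^q))) ≤ F_fix(x)`. [folklore] -/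
theorem ringDeficit_fix_floor :
    ∃ K : ℝ, 0 < K ∧ ∃ q : ℝ, 0 ≤ q ∧ ∃ L₀ : ℕ, ∀ (L : ℕ) [NeZero L], L₀ ≤ L →
      ∀ z : Fin 3 → Bool, z ≠ (fun _ => false) → ∀ ρ : ℝ, 0 < ρ →
      ∀ x : (OffIdx L → SU2) × ((Fin (2 * L - 1) → GaugeConfig 3 L SU2) × (Site 3 L → SU2)),
        ρ ≤ sInf ((fun x' : (OffIdx L → SU2) × ((Fin (2 * L - 1) → GaugeConfig 3 L SU2) × (Site 3 L → SU2)) =>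
            (∑ i : Fin (2 * L - 1 + 1), (6 * (L : ℝ) ^ 3 - timeCoupling su2Rep
              ((Fin.cons (glue x.1) x.2.1 : Fin (2 * L - 1 + 1) → GaugeConfig 3 L SU2) i)
              ((Fin.cons (glue x'.1) x'.2.1 : Fin (2 * L - 1 + 1) → GaugeConfig 3 L SU2) i))) +
              ∑ y : Site 3 L, (2 - ((su2Rep (x.2.2 y * (x'.2.2 y)⁻¹)).trace).re)) ''
            {x' | ringDeficit L z ((Fin.cons (glue x'.1) x'.2.1 : Fin (2 * L - 1 + 1) → GaugeConfig 3 L SU2), x'.2.2) = 0}) →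
        min (K * (L : ℝ) ^ q)⁻¹ (ρ / (1010 * (L : ℝ) ^ 6 * (K * (L : ℝ) ^ q))) ≤
          ringDeficit L z ((Fin.cons (glue x.1) x.2.1 : Fin (2 * L - 1 + 1) → GaugeConfig 3 L SU2), x.2.2) := by
  obtain ⟨K, hK, q, hq, L₀, h⟩ := ringDeficit_floor_off_tube
  refine ⟨K, hK, q, hq, L₀, fun L _ hL z hz ρ hρ x hρx => ?_⟩
  set P : (Fin (2 * L - 1 + 1) → GaugeConfig 3 L SU2) × (Site 3 L → SU2) :=
    ((Fin.cons (glue x.1) x.2.1 : Fin (2 * L - 1 + 1) → GaugeConfig 3 L SU2), x.2.2) with hPdef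
  have hL1 : (1 : ℝ) ≤ L := by exact_mod_cast Nat.one_le_iff_ne_zero.mpr (NeZero.ne L)
  have hc : 0 < 1010 * (L : ℝ) ^ 6 := by positivity
  have hP0 : ∀ e : Edge 3 L, treeEdge e = true → P.1 0 e = 1 := fun e he => by
    show (Fin.cons (glue x.1) x.2.1 : Fin (2 * L - 1 + 1) → GaugeConfig 3 L SU2) 0 e = 1
    rw [Fin.cons_zero, glue_apply_of_tree _ he]
  -- the distance function of the statement is `D(P, ι ·)`
  have hDfun : (fun x' : (OffIdx L → SU2) × ((Fin (2 * L - 1) → GaugeConfig 3 L SU2) × (Site 3 L → SU2)) =>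
      (∑ i : Fin (2 * L - 1 + 1), (6 * (L : ℝ) ^ 3 - timeCoupling su2Rep
        ((Fin.cons (glue x.1) x.2.1 : Fin (2 * L - 1 + 1) → GaugeConfig 3 L SU2) i)
        ((Fin.cons (glue x'.1) x'.2.1 : Fin (2 * L - 1 + 1) → GaugeConfig 3 L SU2) i))) +
        ∑ y : Site 3 L, (2 - ((su2Rep (x.2.2 y * (x'.2.2 y)⁻¹)).trace).re)) =
      (fun x' : (OffIdx L → SU2) × ((Fin (2 * L - 1) → GaugeConfig 3 L SU2) × (Site 3 L → SU2)) =>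
        (∑ i : Fin (2 * L - 1 + 1), (6 * (L : ℝ) ^ 3 - timeCoupling su2Rep (P.1 i)
          ((Fin.cons (glue x'.1) x'.2.1 : Fin (2 * L - 1 + 1) → GaugeConfig 3 L SU2) i))) +
          ∑ y : Site 3 L, (2 - ((su2Rep (P.2 y * (x'.2.2 y)⁻¹)).trace).re)) := rfl
  rw [hDfun] at hρx
  by_cases hne : ({Q : (Fin (2 * L - 1 + 1) → GaugeConfig 3 L SU2) × (Site 3 L → SU2) | ringDeficit L z Q = 0}).Nonempty
  · -- transfer: `inf_Z D(P,·) ≥ inf_{Z ∩ comb-gauged} D(P,·) / (1010 L⁶) ≥ ρ/(1010 L⁶)`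
    have htr := sInf_ringDistSq_combGauged_zero_le z P hP0 hne
    have hsub := image_ringDistSq_combGauged_subset z P
    -- the comb-gauged infimum is ≥ ρ
    have hT : ρ ≤ sInf ((fun Q : (Fin (2 * L - 1 + 1) → GaugeConfig 3 L SU2) × (Site 3 L → SU2) =>
        (∑ i : Fin (2 * L - 1 + 1), (6 * (L : ℝ) ^ 3 - timeCoupling su2Rep (P.1 i) (Q.1 i))) +
          ∑ y : Site 3 L, (2 - ((su2Rep (P.2 y * (Q.2 y)⁻¹)).trace).re)) ''
        {Q | ringDeficit L z Q = 0 ∧ ∀ e : Edge 3 L, treeEdge e = true → Q.1 0 e = 1}) := by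
      by_cases hneT : ((fun Q : (Fin (2 * L - 1 + 1) → GaugeConfig 3 L SU2) × (Site 3 L → SU2) =>
          (∑ i : Fin (2 * L - 1 + 1), (6 * (L : ℝ) ^ 3 - timeCoupling su2Rep (P.1 i) (Q.1 i))) +
            ∑ y : Site 3 L, (2 - ((su2Rep (P.2 y * (Q.2 y)⁻¹)).trace).re)) ''
          {Q | ringDeficit L z Q = 0 ∧ ∀ e : Edge 3 L, treeEdge e = true → Q.1 0 e = 1}).Nonempty
      · refine le_csInf hneT fun v hv => ?_
        have hv' := hsub hv
        have hbdd : BddBelow ((fun x' : (OffIdx L → SU2) × ((Fin (2 * L - 1) → GaugeConfig 3 L SU2) × (Site 3 L → SU2)) =>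
            (∑ i : Fin (2 * L - 1 + 1), (6 * (L : ℝ) ^ 3 - timeCoupling su2Rep (P.1 i)
              ((Fin.cons (glue x'.1) x'.2.1 : Fin (2 * L - 1 + 1) → GaugeConfig 3 L SU2) i))) +
              ∑ y : Site 3 L, (2 - ((su2Rep (P.2 y * (x'.2.2 y)⁻¹)).trace).re)) ''
            {x' | ringDeficit L z ((Fin.cons (glue x'.1) x'.2.1 : Fin (2 * L - 1 + 1) → GaugeConfig 3 L SU2), x'.2.2) = 0}) :=
          ⟨0, by rintro _ ⟨x', -, rfl⟩; exact ringDistSq_nonneg P ((Fin.cons (glue x'.1) x'.2.1 : Fin (2 * L - 1 + 1) → GaugeConfig 3 L SU2), x'.2.2)⟩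
        exact hρx.trans (csInf_le hbdd hv')
      · -- empty comb-gauged zero set contradicts `hne` via the transfer element; but then the image is nonempty — so this case is vacuous
        exfalso
        obtain ⟨Q, hQ⟩ := hne
        apply hneT
        refine ⟨_, ⟨((fun i => gaugeTransform (treeGauge (Q.1 0)) (Q.1 i), treeGauge (Q.1 0) * Q.2 * (treeGauge (Q.1 0))⁻¹) :
          (Fin (2 * L - 1 + 1) → GaugeConfig 3 L SU2) × (Site 3 L → SU2)), ⟨?_, fun e he => ?_⟩, rfl⟩⟩
        · show ringDeficit L z _ = 0
          rw [ringDeficit_ringGaugeAct z (treeGauge (Q.1 0)) Q]; exact hQ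
        · exact treeFix_eq_one_of_treeEdge (Q.1 0) he
    have hZ : ρ / (1010 * (L : ℝ) ^ 6) ≤ sInf ((fun Q : (Fin (2 * L - 1 + 1) → GaugeConfig 3 L SU2) × (Site 3 L → SU2) =>
        (∑ i : Fin (2 * L - 1 + 1), (6 * (L : ℝ) ^ 3 - timeCoupling su2Rep (P.1 i) (Q.1 i))) +
          ∑ y : Site 3 L, (2 - ((su2Rep (P.2 y * (Q.2 y)⁻¹)).trace).re)) '' {Q | ringDeficit L z Q = 0}) := by
      rw [div_le_iff₀ hc]
      linarith
    have hmain := h L hL z hz (ρ / (1010 * (L : ℝ) ^ 6)) (by positivity) P hZ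
    have e : ρ / (1010 * (L : ℝ) ^ 6) / (K * (L : ℝ) ^ q) = ρ / (1010 * (L : ℝ) ^ 6 * (K * (L : ℝ) ^ q)) := by rw [div_div]
    rw [e] at hmain
    exact hmain
  · -- no zeros at all: the hypothesis `ρ ≤ sInf ∅ = 0` contradicts `0 < ρ`
    exfalso
    have hempty : {x' : (OffIdx L → SU2) × ((Fin (2 * L - 1) → GaugeConfig 3 L SU2) × (Site 3 L → SU2)) |
        ringDeficit L z ((Fin.cons (glue x'.1) x'.2.1 : Fin (2 * L - 1 + 1) → GaugeConfig 3 L SU2), x'.2.2) = 0} = ∅ := by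
      ext x'
      simp only [mem_setOf_eq, mem_empty_iff_false, iff_false]
      intro hx'
      exact hne ⟨_, hx'⟩
    rw [hempty, image_empty, Real.sInf_empty] at hρx
    linarith

end Summit.QuantumFields.YangMills.Theorems.QuantitativeLaplace
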